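import Mathlib
import Summits.Ventures.HodgeRepro.Tier4.Line4.LevelTailInstance
import Summits.Ventures.HodgeRepro.Tier4.Line4.LevelTail

/-!
# Tier4/Line4/LevelTailHav — C-L4-HAV-BLOCK: the `hAv` binder of the level-measure assembly on the level sets, from
the transporter separation and the folded ratio bound

Blind re-derivation cell `pub-hodge-repro`, Tier 4 «prove the step» (README §9–§10), LINE L4, seat t4-x2 (g5, reserve
wall-breaker; plan-4 g5's cut S15269, taken S15300).  Tree path `lean/Summits/Ventures/HodgeRepro/Tier4/Line4/LevelTailHav.lean`.
Imports `Line4/LevelTailInstance` (p705148: `levelSuppSet`, `measure_restrict_prod_levelSuppSet`, `suppMeasureFolded_ne_top`,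
`le_ofReal_of_toReal_le`) and `Line4/LevelTail` (p704492: the assembly whose binder is instantiated).  Mathlib-level;
no literature; no `def`.

WHAT.  The level-measure assembly `exists_fibreDominated_of_level_decay_count` (LevelTail) asks, for the level supports
`A N γ`, the binder `hAv : ∀ N γ, orbitOf γ ∉ E → ((μ_T|_{D_T}) ⊗ (μ_{T′}|_{D_{T′}})) (A N γ) ≤ ofReal (v N)`.  On the
adelic instance `A N γ := levelSuppSet W γ₀ (lev N) γ` (L2-p1's level set, no `D_T` clause) the rational points split
into the TRANSPORTER ones (`γ⁻¹ T γ = T′`, L2-p3's C-L4-TRANSPORTER-SEP: from some level on their level set is EMPTY)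
and the others, where the RATIO display bounds the folded support measure by a constant times the UNIT `u N`.  The unit
is a PARAMETER here (`u : ℕ → ℝ`): the ratio hypothesis and the conclusion carry the SAME `u` (crit-1 Entry 146 (iii),
crit-2 Entry 262: one unit on both sides), and the planner's unit ruling (α)/(β) picks `u` at the instantiation —
nothing in this module fixes it.

* `levelSuppSet_eq_empty_of_forall_notMem` — the pointwise separation (L2-p3's `exists_level_separates_transporter`
  shape, `∀ t ∈ T, ∀ t′ ∈ T′, (t⁻¹ γ t′)_f ∉ K(N) γ₀,f K(N)`) empties the level set.
* **`measure_restrict_prod_levelSuppSet_le_of_sep_ratio`** — THE `hAv` BLOCK for one rational `γ`: separation on the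
  transporter predicate `P`, the folded ratio off `P`, hence the restricted product measure of the level set is
  `≤ ofReal (c · u N)` for EVERY rational `γ` (the `orbitOf γ ∉ E` premise is not needed).
* **`hAv_levelSuppSet_of_sep_ratio`** — the same, BINDER-EXACT for `Setting.ofAdelicData` (`S.T = torusT W`,
  `S.μT = R.μT`, `S.DT = R.DT` by `rfl`): literally LevelTail's `hAv` at `A N γ := levelSuppSet W γ₀ (lev N) γ` and
  `v N := c * u N`, for any fibre `E`.
* `hv_of_pos` — the companion `hv : ∀ N, 0 < c * u N` from `0 < c` and `0 < u N` (the unit is positive by name,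
  `levelNorm_inv_mul_suppMeasure_pos` / `levelNorm_le_suppMeasure` on the planner's choice).

Nothing here says anything about the status of the Hodge conjecture for CM abelian varieties, which is NOT proved
(HC_CM is NOT proved by anyone in this repository).
-/

set_option autoImplicit false

noncomputable section

namespace Summit.Ventures.HodgeRepro.Tier4.Line4

open MeasureTheory Summit.Ventures.HodgeRepro.Tier4 Summit.Ventures.HodgeRepro.Tier4.Common
  Summit.Ventures.HodgeRepro.Tier4.Line1

open scoped ENNReal

section Block

variable {k : Type} [Field k] [NumberField k] (W : PlaneData k)

/-- The pointwise separation (`∀ t ∈ T, ∀ t′ ∈ T′, (t⁻¹ γ t′)_f ∉ K(N) γ₀,f K(N)`, the shape of C-L4-TRANSPORTER-SEP)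
empties the level support set. -/
theorem levelSuppSet_eq_empty_of_forall_notMem (γ₀ : GA W) (N : ℕ) (γ : GA W)
    (h : ∀ t ∈ torusT W, ∀ t' ∈ torusT' W,
      GA.ofFinPart W (t⁻¹ * γ * t') ∉ levelDoubleCoset W N (GA.ofFinPart W γ₀)) :
    levelSuppSet W γ₀ N γ = ∅ := by
  ext p
  simp only [levelSuppSet, Set.mem_setOf_eq, Set.mem_empty_iff_false, iff_false]
  exact h (p.1 : GA W) p.1.2 (p.2 : GA W) p.2.2

variable [MeasurableSpace (GA W)] [BorelSpace (GA W)] (R : RTFData W)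

/-- **THE `hAv` BLOCK** (C-L4-HAV-BLOCK, one rational point): with a predicate `P` on the rational points (the
transporter ones), the SEPARATION `hsep` (on `P`, at every level `lev N ≠ 0` of the family: the level set is empty) and
the folded RATIO bound `hratio` (off `P`: `(μ_T ⊗ μ_{T′})(A_N γ)` in `.toReal` is at most `c · u N`, `u` the unit of
the display), the restricted product measure of the level set at EVERY rational `γ` is at most `ofReal (c · u N)`. -/
theorem measure_restrict_prod_levelSuppSet_le_of_sep_ratio (hR : R.IsHaar) (γ₀ : GA W) (lev : ℕ → ℕ)
    (hlev : ∀ N, lev N ≠ 0) (P : rationalPoints W → Prop) (c : ℝ) (u : ℕ → ℝ)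
    (hsep : ∀ N (γ : rationalPoints W), P γ → ∀ t ∈ torusT W, ∀ t' ∈ torusT' W,
      GA.ofFinPart W (t⁻¹ * (γ : GA W) * t') ∉ levelDoubleCoset W (lev N) (GA.ofFinPart W γ₀))
    (hratio : ∀ N (γ : rationalPoints W), ¬ P γ →
      (suppMeasureFolded W R γ₀ (lev N) (γ : GA W)).toReal ≤ c * u N)
    (N : ℕ) (γ : rationalPoints W) :
    ((R.μT.restrict R.DT).prod (R.μT'.restrict R.DT')) (levelSuppSet W γ₀ (lev N) (γ : GA W)) ≤
      ENNReal.ofReal (c * u N) := by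
  by_cases hP : P γ
  · rw [levelSuppSet_eq_empty_of_forall_notMem W γ₀ (lev N) (γ : GA W) (hsep N γ hP), measure_empty]
    exact zero_le
  · rw [measure_restrict_prod_levelSuppSet W R hR γ₀ (hlev N) (γ : GA W)]
    exact le_ofReal_of_toReal_le (suppMeasureFolded_ne_top W R hR γ₀ (lev N) (γ : GA W)) (hratio N γ hP)

/-- The companion positivity `hv : ∀ N, 0 < v N` for `v N := c * u N`. -/
theorem hv_of_pos {c : ℝ} (hc : 0 < c) {u : ℕ → ℝ} (hu : ∀ N, 0 < u N) : ∀ N, 0 < c * u N :=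
  fun N => mul_pos hc (hu N)

end Block

section Instance

variable {k : Type} [Field k] [NumberField k] (W : PlaneData k) [MeasurableSpace (GA W)] [BorelSpace (GA W)]
  (R : RTFData W) (μ : Measure (GA W)) [μ.IsHaarMeasure] [R.μT.IsHaarMeasure] [R.μT'.IsHaarMeasure]
  (DG : Set (GA W)) (fdG : IsFundamentalDomain (rationalPoints W) DG μ) (compG : IsCompact (closure DG))
  (compT : IsCompact (closure R.DT)) (compT' : IsCompact (closure R.DT'))

/-- **THE `hAv` BINDER OF `exists_fibreDominated_of_level_decay_count`, BINDER-EXACT on `Setting.ofAdelicData`**: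
for `A N γ := levelSuppSet W γ₀ (lev N) γ` and `v N := c * u N`, from the separation and the folded ratio bound —
for any fibre `E` (the premise `orbitOf γ ∉ E` is not used). -/
theorem hAv_levelSuppSet_of_sep_ratio (hR : R.IsHaar) (γ₀ : GA W) (lev : ℕ → ℕ) (hlev : ∀ N, lev N ≠ 0)
    (P : rationalPoints W → Prop) (c : ℝ) (u : ℕ → ℝ)
    (hsep : ∀ N (γ : rationalPoints W), P γ → ∀ t ∈ torusT W, ∀ t' ∈ torusT' W,
      GA.ofFinPart W (t⁻¹ * (γ : GA W) * t') ∉ levelDoubleCoset W (lev N) (GA.ofFinPart W γ₀))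
    (hratio : ∀ N (γ : rationalPoints W), ¬ P γ →
      (suppMeasureFolded W R γ₀ (lev N) (γ : GA W)).toReal ≤ c * u N)
    (E : Finset (Setting.ofAdelicData W R μ DG fdG compG compT compT').Orbit) :
    ∀ N (γ : (Setting.ofAdelicData W R μ DG fdG compG compT compT').Gk),
      (Setting.ofAdelicData W R μ DG fdG compG compT compT').orbitOf γ ∉ E →
      (((Setting.ofAdelicData W R μ DG fdG compG compT compT').μT.restrict
          (Setting.ofAdelicData W R μ DG fdG compG compT compT').DT).prod
        ((Setting.ofAdelicData W R μ DG fdG compG compT compT').μT'.restrict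
          (Setting.ofAdelicData W R μ DG fdG compG compT compT').DT'))
        (levelSuppSet W γ₀ (lev N) (γ : GA W)) ≤ ENNReal.ofReal (c * u N) :=
  fun N γ _ => measure_restrict_prod_levelSuppSet_le_of_sep_ratio W R hR γ₀ lev hlev P c u hsep hratio N γ

end Instance

end Summit.Ventures.HodgeRepro.Tier4.Line4

end
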